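import Summits.CriticalPhenomena.Ising3D.Control2DTail
import Summits.CriticalPhenomena.Ising3D.BlockTaylorGermFamilies
import Mathlib.Analysis.SpecialFunctions.Pow.Real
import Mathlib.Tactic.Linarith
import Mathlib.Tactic.Positivity
import Mathlib.Tactic.Ring
import HarnessLib

/-!
# Taylor (derivative) functionals act termwise on the pair-monomial series of one 2D block
(cell `pub-ising3x`, seat controls-1 gen 14; KERNEL PATH for the 2D γ (derivative-functional)
certificates, step 1c — CONTROL-ONLY)

HONEST FRAMING: lottery ticket; floor = tightest certified 3D Ising CFT bounds; no exact-solution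
claim without a proof. CONTROL-ONLY (`d = 2`); nothing numerical is asserted here.

`Control2DTermwise.high_nonneg_of_pairPositive` reduces the above-threshold obligation
`GapObligations.high_nonneg` (block positivity for EVERY `Δ ≥ E₀`) to the pair-monomial obligation
`PairPositiveAbove φ s E₀` — `φ[F_-[x^a y^b + x^b y^a]] ≥ 0` for `a + b ≥ E₀`, `a - b ∈ ℤ`, which is what a
reader's region step (`Qa(E, j²) ≥ 0`) establishes — for EVALUATION-CONTINUOUS `φ`. This file proves the
same reduction for boot-1's Taylor (derivative) functionals at a diagonal point
(`high_nonneg_of_pairPositive_taylor`), by the M-test on germs: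

* `pairCoeff`, `pairK`, `isDoublePowerSeriesOn_pairK`, `pairPow_eq_shape`: the pair monomial with
  `a = b + J`, `J ∈ ℕ`, is of the 3D chain's block shape `(z z̄)^b (z^J + z̄^J)` (a finite array);
* `hasSummableGerms_pairPow`: the family `F^{s}_-[pairPow (h+m) (h̄+m')]` with weights
  `a_m(h) a_{m'}(h̄) ≥ 0` has summable germs at `(x,x)` (boot-1's `hasSummableGerms_of_blockShape`; the
  majorant values are the pair monomials at two diagonal points, summing to the block values there,
  `hasSum_blockPair`);
* `high_nonneg_of_pairPositive_taylor`: hence `φ` acts term by term on the non-negative expansion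
  `hasSum_crossF_globalBlock`, and `PairPositiveAbove φ s E₀` gives `BlockPositive φ s Δ ℓ` for all
  `ℓ ≤ Δ`, `E₀ ≤ Δ`.

Sources: F. A. Dolan, H. Osborn, Nucl. Phys. B 678 (2004) 491, §3; R. Rattazzi, V. S. Rychkov,
E. Tonni, A. Vichi, JHEP 12 (2008) 031, §5.5 (control of the functional outside the trial set);
boot-1's `TaylorFunctional` / `BlockTaylorGerm(Families)`, `pairPow_comm` / `pairPow_eq_of_nat`
(`Control2DTail`) (tree).
-/

namespace Summit.CriticalPhenomena.Ising3D.Control2D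

open Set
open Literature.MathematicalPhysics.QuantumFieldTheory.ConformalBootstrap3D

/-! ### Pair monomials in block shape -/

/-- The (finite) coefficient array of `K_J(z,z̄) = z^J + z̄^J`: `1` at `(J,0)` and at `(0,J)` (so `2` at
`(0,0)` when `J = 0`). [folklore] -/
noncomputable def pairCoeff (J : ℕ) (p : ℕ × ℕ) : ℝ :=
  (if p = (J, 0) then 1 else 0) + (if p = (0, J) then 1 else 0)

/-- `K_J(z,z̄) = z^J + z̄^J`. [folklore] -/
noncomputable def pairK (J : ℕ) (z zb : ℝ) : ℝ := z ^ J + zb ^ J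

/-- The pair array is non-negative. [folklore] -/
theorem pairCoeff_nonneg (J : ℕ) (p : ℕ × ℕ) : 0 ≤ pairCoeff J p := by
  unfold pairCoeff
  refine add_nonneg ?_ ?_ <;> split_ifs <;> norm_num

/-- Off `{(J,0), (0,J)}` the pair array vanishes. [folklore] -/
theorem pairCoeff_eq_zero {J : ℕ} {p : ℕ × ℕ} (hp : p ∉ ({(J, 0), (0, J)} : Finset (ℕ × ℕ))) :
    pairCoeff J p = 0 := by
  simp only [Finset.mem_insert, Finset.mem_singleton, not_or] at hp
  simp [pairCoeff, hp.1, hp.2]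

/-- **`K_J` is a (finite) double power series on the bidisk.** [folklore] -/
theorem isDoublePowerSeriesOn_pairK (J : ℕ) : IsDoublePowerSeriesOn (pairCoeff J) (pairK J) := by
  intro z zb _ _
  refine ⟨summable_of_ne_finset_zero (s := ({(J, 0), (0, J)} : Finset (ℕ × ℕ)))
    fun p hp => by rw [pairCoeff_eq_zero hp]; simp, ?_⟩
  rw [tsum_eq_sum (s := ({(J, 0), (0, J)} : Finset (ℕ × ℕ)))
    fun p hp => by rw [pairCoeff_eq_zero hp]; simp]
  by_cases hJ : J = 0
  · subst hJ
    simp [pairCoeff, pairK]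
  · have hne : ((J, 0) : ℕ × ℕ) ≠ (0, J) := by simp [hJ]
    rw [Finset.sum_pair hne]
    have h10 : ((J, 0) : ℕ × ℕ) ≠ (0, J) := hne
    have h01 : ((0, J) : ℕ × ℕ) ≠ (J, 0) := fun h => hne h.symm
    simp [pairCoeff, pairK, h10, h01]

/-- **The pair monomial is of block shape**: for `z, z̄ > 0`,
`pairPow (b + J) b (z,z̄) = z^{b+J} z̄^b + z^b z̄^{b+J} = (z z̄)^b (z^J + z̄^J)` (the tree's
`pairPow_eq_of_nat`, restated with `pairK`). [folklore] -/
theorem pairPow_eq_shape (b : ℝ) (J : ℕ) {z zb : ℝ} (hz : 0 < z) (hzb : 0 < zb) :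
    pairPow (b + J) b z zb = (z * zb) ^ b * pairK J z zb := by
  rw [pairPow_eq_of_nat hz hzb J]
  rfl

/-- The pair monomial on the diagonal: `pairPow a b (y,y) = 2 y^{a+b}` (`y > 0`). [folklore] -/
theorem pairPow_diag {a b y : ℝ} (hy : 0 < y) : pairPow a b y y = 2 * y ^ (a + b) := by
  unfold pairPow
  rw [Real.rpow_add hy]
  ring

/-! ### The pair-monomial series of one block -/

/-- **Summable Taylor germs of the pair-monomial expansion of one block.** For `ℓ ≤ Δ` the family
`F^{s}_-[pairPow (h+m) (h̄+m')]`, weights `a_m(h) a_{m'}(h̄)`, has summable germs at every diagonal point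
`(x,x)` (majorant radius `ρ < x(1-x)`): each pair monomial is of block shape `(z z̄)^{min} (z^J + z̄^J)`
(`pairPow_eq_shape`) and the majorant values `pairPow (X,X)` sum to the block value `g_{Δ,ℓ}(X,X)`
(`hasSum_blockPair`). [folklore] -/
theorem hasSummableGerms_pairPow {Δ : ℝ} {ℓ : ℕ} (hΔ : (ℓ : ℝ) ≤ Δ) (s : ℝ) {x ρ : ℝ}
    (hx0 : 0 < x) (hx1 : x < 1) (hρ0 : 0 < ρ) (hρ : ρ < x * (1 - x)) :
    HasSummableGerms
      (fun mm : ℕ × ℕ => chiralCoeff ((Δ + ℓ) / 2) mm.1 * chiralCoeff ((Δ - ℓ) / 2) mm.2)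
      (fun mm => crossF s (-1) (pairPow ((Δ + ℓ) / 2 + (mm.1 : ℝ)) ((Δ - ℓ) / 2 + (mm.2 : ℝ))))
      x x ρ := by
  have hℓ : (0 : ℝ) ≤ ℓ := Nat.cast_nonneg ℓ
  have hh : 0 ≤ (Δ + ℓ) / 2 := by linarith
  have hhb : 0 ≤ (Δ - ℓ) / 2 := by linarith
  have hX₁ := bgX₁_pos_lt hx0 hρ
  have hX₂ := bgX₂_pos_lt hx1 hρ
  -- the block shape of each pair monomial (case split on the sign of `a - b = ℓ + m - m'`)
  have hshape : ∀ (mm : ℕ × ℕ) (z zb : ℝ), z ∈ Ioo (0 : ℝ) 1 → zb ∈ Ioo (0 : ℝ) 1 →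
      pairPow ((Δ + ℓ) / 2 + (mm.1 : ℝ)) ((Δ - ℓ) / 2 + (mm.2 : ℝ)) z zb =
        (z * zb) ^ (if mm.2 ≤ ℓ + mm.1 then (Δ - ℓ) / 2 + (mm.2 : ℝ) else (Δ + ℓ) / 2 + (mm.1 : ℝ)) *
          pairK (if mm.2 ≤ ℓ + mm.1 then ℓ + mm.1 - mm.2 else mm.2 - ℓ - mm.1) z zb := by
    intro mm z zb hz hzb
    by_cases hc : mm.2 ≤ ℓ + mm.1
    · have hJ : (Δ + ℓ) / 2 + (mm.1 : ℝ) =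
          ((Δ - ℓ) / 2 + (mm.2 : ℝ)) + ((ℓ + mm.1 - mm.2 : ℕ) : ℝ) := by
        rw [Nat.cast_sub hc]; push_cast; ring
      simp only [if_pos hc]
      rw [hJ, pairPow_eq_shape _ _ hz.1 hzb.1]
    · have hc' : ℓ + mm.1 ≤ mm.2 := by omega
      have hJ : (Δ - ℓ) / 2 + (mm.2 : ℝ) =
          ((Δ + ℓ) / 2 + (mm.1 : ℝ)) + ((mm.2 - ℓ - mm.1 : ℕ) : ℝ) := by
        rw [Nat.sub_sub, Nat.cast_sub hc']; push_cast; ring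
      simp only [if_neg hc]
      rw [pairPow_comm, hJ, pairPow_eq_shape _ _ hz.1 hzb.1]
  refine hasSummableGerms_of_blockShape _ _ s (-1) hx0 hx1 hρ0 hρ
    (fun mm => pairCoeff (if mm.2 ≤ ℓ + mm.1 then ℓ + mm.1 - mm.2 else mm.2 - ℓ - mm.1))
    (fun mm => pairK (if mm.2 ≤ ℓ + mm.1 then ℓ + mm.1 - mm.2 else mm.2 - ℓ - mm.1))
    (fun mm => if mm.2 ≤ ℓ + mm.1 then (Δ - ℓ) / 2 + (mm.2 : ℝ) else (Δ + ℓ) / 2 + (mm.1 : ℝ))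
    (fun mm => isDoublePowerSeriesOn_pairK _)
    (fun mm => ?_) hshape
    (fun mm => pairPow ((Δ + ℓ) / 2 + (mm.1 : ℝ)) ((Δ - ℓ) / 2 + (mm.2 : ℝ)) (bgX₁ x ρ) (bgX₁ x ρ))
    (fun mm => pairPow ((Δ + ℓ) / 2 + (mm.1 : ℝ)) ((Δ - ℓ) / 2 + (mm.2 : ℝ)) (bgX₂ x ρ) (bgX₂ x ρ))
    (fun mm => le_of_eq ?_) (fun mm => le_of_eq ?_) ?_ ?_
  · have h1 : (0 : ℝ) ≤ mm.1 := Nat.cast_nonneg _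
    have h2 : (0 : ℝ) ≤ mm.2 := Nat.cast_nonneg _
    split_ifs <;> linarith
  · rw [rpow_mul_tsum_abs_eq (isDoublePowerSeriesOn_pairK _) (pairCoeff_nonneg _) _ hX₁.1 hX₁.2,
      ← hshape mm _ _ hX₁ hX₁]
  · rw [rpow_mul_tsum_abs_eq (isDoublePowerSeriesOn_pairK _) (pairCoeff_nonneg _) _ hX₂.1 hX₂.2,
      ← hshape mm _ _ hX₂ hX₂]
  · refine (hasSum_blockPair hh hhb hX₁ hX₁).summable.congr fun mm => ?_
    rw [abs_of_nonneg (mul_nonneg (chiralCoeff_nonneg hh _) (chiralCoeff_nonneg hhb _))]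
  · refine (hasSum_blockPair hh hhb hX₂ hX₂).summable.congr fun mm => ?_
    rw [abs_of_nonneg (mul_nonneg (chiralCoeff_nonneg hh _) (chiralCoeff_nonneg hhb _))]

/-- **Termwise reduction of the above-threshold obligation for Taylor functionals** (twin of
`high_nonneg_of_pairPositive`): for a Taylor functional `φ` at a diagonal point `(x,x)`, `0 < x < 1`,
the pair-monomial obligation `PairPositiveAbove φ s E₀` implies `BlockPositive φ s Δ ℓ` for every
`ℓ ≤ Δ` with `E₀ ≤ Δ` — `φ` acts term by term on the non-negative pair-monomial expansion of
`F_-[g_{Δ,ℓ}]` (`hasSum_crossF_globalBlock`, M-test `hasSummableGerms_pairPow`).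
[cite: RattazziEtAl2008, §5.5] -/
theorem high_nonneg_of_pairPositive_taylor {φ : (ℝ → ℝ → ℝ) →ₗ[ℝ] ℝ} {s x E₀ : ℝ}
    (hφ : IsTaylorFunctional x x φ) (hx0 : 0 < x) (hx1 : x < 1) (h : PairPositiveAbove φ s E₀) :
    ∀ ℓ : ℕ, ∀ Δ : ℝ, (ℓ : ℝ) ≤ Δ → E₀ ≤ Δ → BlockPositive φ s Δ ℓ := by
  intro ℓ Δ hΔ hE
  have hℓ : (0 : ℝ) ≤ ℓ := Nat.cast_nonneg ℓ
  have hr : 0 < x * (1 - x) := mul_pos hx0 (by linarith)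
  have hρ0 : 0 < x * (1 - x) / 2 := by positivity
  have hρ : x * (1 - x) / 2 < x * (1 - x) := by linarith
  have hs := hφ.hasSum_mul_of_hasSummableGerms hρ0 (hasSummableGerms_pairPow hΔ s hx0 hx1 hρ0 hρ)
    (crossF s (-1) (globalBlock Δ ℓ)) (fun h' k hh hk =>
      hasSum_crossF_globalBlock hΔ (mem_Ioo_of_abs_lt (hh.trans hρ)) (mem_Ioo_of_abs_lt (hk.trans hρ)))
  refine hs.nonneg fun mm => mul_nonneg ?_ ?_
  · exact mul_nonneg (chiralCoeff_nonneg (by linarith) _) (chiralCoeff_nonneg (by linarith) _)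
  · refine h _ _ ?_ ?_ ?_ ⟨(ℓ : ℤ) + mm.1 - mm.2, ?_⟩
    · have : (0 : ℝ) ≤ mm.1 := Nat.cast_nonneg _
      linarith
    · have : (0 : ℝ) ≤ mm.2 := Nat.cast_nonneg _
      linarith
    · have h1 : (0 : ℝ) ≤ mm.1 := Nat.cast_nonneg _
      have h2 : (0 : ℝ) ≤ mm.2 := Nat.cast_nonneg _
      linarith
    · push_cast
      ring

end Summit.CriticalPhenomena.Ising3D.Control2D
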